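import Summits.QuantumFields.QCD.Theorems.GaussianLinkFramesFrameFMClosureTwoStarOfPaddedAux9

/-!
# Crux `GaussianLinkFrames.FrameFMClosure` (stmt-QuantumFields-17375), line `pad-the-fibre`, stub
`stub_placementCollar` — helper 1: the canonical collar pad region of ONE point, in integer coordinates (sets and
region inclusions)

The (collar) placement of clause (T1) is built in the integer chart `a ↦ x + proj a` of the torus about the collar
centre `x` (faithful on `[-S, S]⁴ ⊇` everything below, since `3ℓ+4 ≤ S`).  For a point with offset `a ∈ Λ̂ ∖ Ŵ`
(`Ŵ = [-ℓ-1, ℓ]⁴`, `Λ̂ = [-3ℓ-3, 3ℓ+2]⁴`) the lead's recipe is: a pad centre `b` (`a - b ∈ {-1,0}⁴`, `b₀ ≡ ℓ mod 2`),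
frozen boundary layers `(M, c)`, a set `E ⊆ M` of "excluded" frozen coordinates (`0 ∉ E`, `M ∖ E ⊆ {d₀}`), and then
* the UNFROZEN BLOCK `Z = {b + w : w ∈ [-2,1]⁴, w_k ≠ c_k ∀ k ∈ E}`,
* the DEFECTS `D = {a + s_k e_k, ā + s_k e_k : k ∈ E}` (`s_k = ±1` the outward sign of layer `k`, `ā` the other core
  site of `a` in direction `0`) — the star of `a` pokes into the excluded layers at `a + s_k e_k`, and one extra rung
  per defect brings in its `0`-neighbour `ā + s_k e_k`,
* the REGION `Q = {links with both endpoints in Z, not both frozen} ∪ {the |E| extra rungs}`.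
This file: the three finite sets exist with these membership descriptions (`collar_sets_exist`), every link of `Q`
is a pad link with not both endpoints frozen (`collar_upper`), `Q` contains every pad link without frozen endpoint
(`collar_lower`), and no link of `Q` lies inside `Ŵ` or inside `Λ̂ᶜ` (`collar_noW`, `collar_noΛ`).  Helpers 2–3 compute
the touched set `Z ∪ D` and its nearest-neighbour pairing; helper 4 transports to the torus.

References: placement recipe of the line card `pad-the-fibre` (triage r1-1 sharpen 1); elementary [folklore].
-/

noncomputable section

open scoped BigOperators
open Literature.Probability.LatticeModels

namespace Summit.QuantumFields.QCD.Theorems.PadTheFibreCollar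

/-- **The three finite sets of the collar recipe exist** (unfrozen block `Z`, defects `D`, region `Q`) with the
stated membership descriptions. [folklore] -/
theorem collar_sets_exist (ℓ : ℕ) (a b c : Site 4) (M E : Finset (Fin 4)) :
    ∃ (Z D : Finset (Site 4)) (Q : Finset (Site 4 × Fin 4)),
      (∀ y : Site 4, y ∈ Z ↔ (∀ i, -2 ≤ y i - b i ∧ y i - b i ≤ 1) ∧ ∀ k ∈ E, y k - b k ≠ c k) ∧
      (∀ y : Site 4, y ∈ D ↔ ∃ k ∈ E,
        y = a + Pi.single k (if c k = 1 then (1 : ℤ) else -1) ∨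
        y = (if (a 0 - (ℓ : ℤ)) % 2 = 0 then a - Pi.single 0 1 else a + Pi.single 0 1) +
              Pi.single k (if c k = 1 then (1 : ℤ) else -1)) ∧
      (∀ q : Site 4 × Fin 4, q ∈ Q ↔
        (q.1 ∈ Z ∧ q.1 + Pi.single q.2 1 ∈ Z ∧
          ¬ ((∃ k ∈ M, q.1 k - b k = c k) ∧ (∃ k ∈ M, (q.1 + Pi.single q.2 1 : Site 4) k - b k = c k))) ∨
        ∃ k ∈ E, q = (if c k = 1 then
            ((if (a 0 - (ℓ : ℤ)) % 2 = 0 then a - Pi.single 0 1 else a + Pi.single 0 1), k)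
          else ((if (a 0 - (ℓ : ℤ)) % 2 = 0 then a - Pi.single 0 1 else a + Pi.single 0 1) - Pi.single k 1, k))) := by
  classical
  set ā : Site 4 := (if (a 0 - (ℓ : ℤ)) % 2 = 0 then a - Pi.single 0 1 else a + Pi.single 0 1) with hā
  set Z : Finset (Site 4) := ((Fintype.piFinset fun _ : Fin 4 => Finset.Icc (-2 : ℤ) 1).image
    fun w => b + w).filter fun y => ∀ k ∈ E, y k - b k ≠ c k with hZdef
  have hZ : ∀ y : Site 4, y ∈ Z ↔ (∀ i, -2 ≤ y i - b i ∧ y i - b i ≤ 1) ∧ ∀ k ∈ E, y k - b k ≠ c k := by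
    intro y
    simp only [hZdef, Finset.mem_filter, Finset.mem_image, Fintype.mem_piFinset, Finset.mem_Icc]
    constructor
    · rintro ⟨⟨w, hw, rfl⟩, h2⟩
      exact ⟨fun i => by simpa using hw i, h2⟩
    · rintro ⟨h1, h2⟩
      exact ⟨⟨y - b, fun i => by simpa using h1 i, by abel⟩, h2⟩
  refine ⟨Z, E.biUnion fun k => {a + Pi.single k (if c k = 1 then (1 : ℤ) else -1),
      ā + Pi.single k (if c k = 1 then (1 : ℤ) else -1)},
    ((Z ×ˢ (Finset.univ : Finset (Fin 4))).filter fun q => q.1 + Pi.single q.2 1 ∈ Z ∧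
        ¬ ((∃ k ∈ M, q.1 k - b k = c k) ∧ (∃ k ∈ M, (q.1 + Pi.single q.2 1 : Site 4) k - b k = c k))) ∪
      E.image fun k => if c k = 1 then (ā, k) else (ā - Pi.single k 1, k), hZ, ?_, ?_⟩
  · intro y
    simp only [Finset.mem_biUnion, Finset.mem_insert, Finset.mem_singleton]
  · intro q
    simp only [Finset.mem_union, Finset.mem_filter, Finset.mem_product, Finset.mem_univ, and_true,
      Finset.mem_image]
    constructor
    · rintro (⟨h1, h2, h3⟩ | ⟨k, hk, h⟩)
      · exact Or.inl ⟨h1, h2, h3⟩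
      · exact Or.inr ⟨k, hk, h.symm⟩
    · rintro (⟨h1, h2, h3⟩ | ⟨k, hk, h⟩)
      · exact Or.inl ⟨h1, h2, h3⟩
      · exact Or.inr ⟨k, hk, h.symm⟩

/-- The other core site `ā` of `a` in direction `0` (`ā = a - e₀` if `a₀ ≡ ℓ`, else `a + e₀`) is again a core site
of the pad about `b`: `ā - b ∈ {-1, 0}⁴`, and `ā` agrees with `a` off coordinate `0`. [folklore] -/
theorem collar_abar_core (ℓ : ℕ) (a b : Site 4) (hcore : ∀ i, a i - b i = 0 ∨ a i - b i = -1)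
    (hpar : (b 0 - (ℓ : ℤ)) % 2 = 0) :
    (∀ i, (if (a 0 - (ℓ : ℤ)) % 2 = 0 then a - Pi.single 0 1 else a + Pi.single 0 1 : Site 4) i - b i = 0 ∨
      (if (a 0 - (ℓ : ℤ)) % 2 = 0 then a - Pi.single 0 1 else a + Pi.single 0 1 : Site 4) i - b i = -1) ∧
    (∀ i, i ≠ 0 → (if (a 0 - (ℓ : ℤ)) % 2 = 0 then a - Pi.single 0 1 else a + Pi.single 0 1 : Site 4) i = a i) := by
  constructor
  · intro i
    have h0 := hcore 0
    have hi := hcore i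
    by_cases hi0 : i = 0
    · subst hi0
      split_ifs with h <;> simp <;> omega
    · split_ifs with h <;> simp [hi0] <;> omega
  · intro i hi0
    split_ifs <;> simp [hi0]

/-- **Every link of the collar region is a pad link with not both endpoints frozen** (the upper inclusion of
`IsPadRegion`, integer form): `q = (b + w, μ)` with `w, w + e_μ ∈ [-2,1]⁴` and not both in a frozen layer. [folklore] -/
theorem collar_upper (ℓ : ℕ) (a b c : Site 4) (M E : Finset (Fin 4))
    (Z : Finset (Site 4)) (Q : Finset (Site 4 × Fin 4))
    (hZ : ∀ y : Site 4, y ∈ Z ↔ (∀ i, -2 ≤ y i - b i ∧ y i - b i ≤ 1) ∧ ∀ k ∈ E, y k - b k ≠ c k)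
    (hQ : ∀ q : Site 4 × Fin 4, q ∈ Q ↔
        (q.1 ∈ Z ∧ q.1 + Pi.single q.2 1 ∈ Z ∧
          ¬ ((∃ k ∈ M, q.1 k - b k = c k) ∧ (∃ k ∈ M, (q.1 + Pi.single q.2 1 : Site 4) k - b k = c k))) ∨
        ∃ k ∈ E, q = (if c k = 1 then
            ((if (a 0 - (ℓ : ℤ)) % 2 = 0 then a - Pi.single 0 1 else a + Pi.single 0 1), k)
          else ((if (a 0 - (ℓ : ℤ)) % 2 = 0 then a - Pi.single 0 1 else a + Pi.single 0 1) - Pi.single k 1, k)))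
    (hcore : ∀ i, a i - b i = 0 ∨ a i - b i = -1) (hpar : (b 0 - (ℓ : ℤ)) % 2 = 0)
    (hc : ∀ k ∈ M, c k = -2 ∨ c k = 1) (hEM : E ⊆ M)
    (q : Site 4 × Fin 4) (hq : q ∈ Q) :
    ∃ w : Site 4, (∀ i, -2 ≤ w i ∧ w i ≤ 1) ∧
      (∀ i, -2 ≤ (w + Pi.single q.2 1 : Site 4) i ∧ (w + Pi.single q.2 1 : Site 4) i ≤ 1) ∧
      q.1 = b + w ∧ ¬ ((∃ k ∈ M, w k = c k) ∧ (∃ k ∈ M, (w + Pi.single q.2 1 : Site 4) k = c k)) := by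
  obtain ⟨hā, hāa⟩ := collar_abar_core ℓ a b hcore hpar
  set ā : Site 4 := (if (a 0 - (ℓ : ℤ)) % 2 = 0 then a - Pi.single 0 1 else a + Pi.single 0 1) with hādef
  -- the core site `ā` is unfrozen
  have hāfr : ¬ ∃ k ∈ M, ā k - b k = c k := by
    rintro ⟨k, hk, h⟩
    rcases hc k hk with h' | h' <;> rcases hā k with h'' | h'' <;> omega
  rw [hQ] at hq
  rcases hq with ⟨h1, h2, h3⟩ | ⟨k, hk, rfl⟩
  · refine ⟨q.1 - b, fun i => ?_, fun i => ?_, by abel, ?_⟩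
    · have := ((hZ _).1 h1).1 i; simpa using this
    · have := ((hZ _).1 h2).1 i
      simp only [Pi.add_apply, Pi.sub_apply] at this ⊢
      constructor <;> linarith [this.1, this.2]
    · rintro ⟨⟨j, hj, hj'⟩, ⟨j', hj'', hj'''⟩⟩
      refine h3 ⟨⟨j, hj, by simpa using hj'⟩, ⟨j', hj'', ?_⟩⟩
      simp only [Pi.add_apply, Pi.sub_apply] at hj''' ⊢
      linarith
  · have hkM : k ∈ M := hEM hk
    by_cases hck : c k = 1
    · simp only [hck, if_true]
      refine ⟨ā - b, fun i => ?_, fun i => ?_, by abel, fun h => hāfr ?_⟩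
      · rcases hā i with h | h <;> simp only [Pi.sub_apply] at h ⊢ <;> omega
      · by_cases hik : i = k
        · subst hik; rcases hā i with h | h <;> simp <;> omega
        · rcases hā i with h | h <;> simp [hik] <;> omega
      · obtain ⟨j, hj, h⟩ := h.1
        exact ⟨j, hj, by simpa using h⟩
    · have hck' : c k = -2 := by rcases hc k hkM with h | h <;> [exact h; exact absurd h hck]
      simp only [hck, if_false]
      refine ⟨ā - b - Pi.single k 1, fun i => ?_, fun i => ?_, by abel, fun h => hāfr ?_⟩
      · by_cases hik : i = k
        · subst hik; rcases hā i with h | h <;> simp <;> omega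
        · rcases hā i with h | h <;> simp [hik] <;> omega
      · rcases hā i with h | h <;> simp <;> omega
      · obtain ⟨j, hj, h⟩ := h.2
        exact ⟨j, hj, by simpa using h⟩

/-- **The collar region contains every pad link without frozen endpoint** (the lower inclusion of `IsPadRegion`,
integer form). [folklore] -/
theorem collar_lower (ℓ : ℕ) (a b c : Site 4) (M E : Finset (Fin 4))
    (Z : Finset (Site 4)) (Q : Finset (Site 4 × Fin 4))
    (hZ : ∀ y : Site 4, y ∈ Z ↔ (∀ i, -2 ≤ y i - b i ∧ y i - b i ≤ 1) ∧ ∀ k ∈ E, y k - b k ≠ c k)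
    (hQ : ∀ q : Site 4 × Fin 4, q ∈ Q ↔
        (q.1 ∈ Z ∧ q.1 + Pi.single q.2 1 ∈ Z ∧
          ¬ ((∃ k ∈ M, q.1 k - b k = c k) ∧ (∃ k ∈ M, (q.1 + Pi.single q.2 1 : Site 4) k - b k = c k))) ∨
        ∃ k ∈ E, q = (if c k = 1 then
            ((if (a 0 - (ℓ : ℤ)) % 2 = 0 then a - Pi.single 0 1 else a + Pi.single 0 1), k)
          else ((if (a 0 - (ℓ : ℤ)) % 2 = 0 then a - Pi.single 0 1 else a + Pi.single 0 1) - Pi.single k 1, k)))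
    (hEM : E ⊆ M) (w : Site 4) (hw : ∀ i, -2 ≤ w i ∧ w i ≤ 1) (μ : Fin 4)
    (hw' : ∀ i, -2 ≤ (w + Pi.single μ 1 : Site 4) i ∧ (w + Pi.single μ 1 : Site 4) i ≤ 1)
    (hfr : ¬ ∃ k ∈ M, w k = c k) (hfr' : ¬ ∃ k ∈ M, (w + Pi.single μ 1 : Site 4) k = c k) :
    (b + w, μ) ∈ Q := by
  rw [hQ]
  left
  refine ⟨(hZ _).2 ⟨fun i => by simpa using hw i, fun k hk h => hfr ⟨k, hEM hk, by simpa using h⟩⟩,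
    (hZ _).2 ⟨fun i => ?_, fun k hk h => hfr' ⟨k, hEM hk, ?_⟩⟩, fun h => hfr ?_⟩
  · have := hw' i
    simp only [Pi.add_apply] at this ⊢
    constructor <;> linarith [this.1, this.2]
  · simp only [Pi.add_apply] at h ⊢
    linarith
  · obtain ⟨k, hk, h⟩ := h.1
    exact ⟨k, hk, by simpa using h⟩

/-- **No link of the collar region lies inside `Ŵ = [-ℓ-1, ℓ]⁴`**, provided every pad site inside `Ŵ` is frozen
(hypothesis `hW`: one frozen layer covers `pad ∩ Ŵ` by convexity, or `pad ∩ Ŵ = ∅`). [folklore] -/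
theorem collar_noW (ℓ : ℕ) (a b c : Site 4) (M E : Finset (Fin 4))
    (Z : Finset (Site 4)) (Q : Finset (Site 4 × Fin 4))
    (hZ : ∀ y : Site 4, y ∈ Z ↔ (∀ i, -2 ≤ y i - b i ∧ y i - b i ≤ 1) ∧ ∀ k ∈ E, y k - b k ≠ c k)
    (hQ : ∀ q : Site 4 × Fin 4, q ∈ Q ↔
        (q.1 ∈ Z ∧ q.1 + Pi.single q.2 1 ∈ Z ∧
          ¬ ((∃ k ∈ M, q.1 k - b k = c k) ∧ (∃ k ∈ M, (q.1 + Pi.single q.2 1 : Site 4) k - b k = c k))) ∨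
        ∃ k ∈ E, q = (if c k = 1 then
            ((if (a 0 - (ℓ : ℤ)) % 2 = 0 then a - Pi.single 0 1 else a + Pi.single 0 1), k)
          else ((if (a 0 - (ℓ : ℤ)) % 2 = 0 then a - Pi.single 0 1 else a + Pi.single 0 1) - Pi.single k 1, k)))
    (hcore : ∀ i, a i - b i = 0 ∨ a i - b i = -1) (hpar : (b 0 - (ℓ : ℤ)) % 2 = 0)
    (hc : ∀ k ∈ M, c k = -2 ∨ c k = 1) (hEM : E ⊆ M)
    (hW : ∀ w : Site 4, (∀ i, -2 ≤ w i ∧ w i ≤ 1) → (∀ i, -(ℓ : ℤ) - 1 ≤ b i + w i ∧ b i + w i ≤ ℓ) →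
      ∃ k ∈ M, w k = c k)
    (q : Site 4 × Fin 4) (hq : q ∈ Q) :
    ¬ ((∀ i, -(ℓ : ℤ) - 1 ≤ q.1 i ∧ q.1 i ≤ ℓ) ∧
      (∀ i, -(ℓ : ℤ) - 1 ≤ (q.1 + Pi.single q.2 1 : Site 4) i ∧ (q.1 + Pi.single q.2 1 : Site 4) i ≤ ℓ)) := by
  obtain ⟨w, hw, hw', hq1, hfr⟩ := collar_upper ℓ a b c M E Z Q hZ hQ hcore hpar hc hEM q hq
  rintro ⟨h1, h2⟩
  refine hfr ⟨hW w hw fun i => ?_, hW _ hw' fun i => ?_⟩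
  · have := h1 i
    rw [hq1] at this
    simpa using this
  · have := h2 i
    rw [hq1] at this
    simpa [add_assoc] using this

/-- **No link of the collar region lies inside `Λ̂ᶜ`** (`Λ̂ = [-3ℓ-3, 3ℓ+2]⁴`), provided every pad site outside `Λ̂`
in some coordinate is frozen in that coordinate (hypothesis `hΛ`). [folklore] -/
theorem collar_noΛ (ℓ : ℕ) (a b c : Site 4) (M E : Finset (Fin 4))
    (Z : Finset (Site 4)) (Q : Finset (Site 4 × Fin 4))
    (hZ : ∀ y : Site 4, y ∈ Z ↔ (∀ i, -2 ≤ y i - b i ∧ y i - b i ≤ 1) ∧ ∀ k ∈ E, y k - b k ≠ c k)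
    (hQ : ∀ q : Site 4 × Fin 4, q ∈ Q ↔
        (q.1 ∈ Z ∧ q.1 + Pi.single q.2 1 ∈ Z ∧
          ¬ ((∃ k ∈ M, q.1 k - b k = c k) ∧ (∃ k ∈ M, (q.1 + Pi.single q.2 1 : Site 4) k - b k = c k))) ∨
        ∃ k ∈ E, q = (if c k = 1 then
            ((if (a 0 - (ℓ : ℤ)) % 2 = 0 then a - Pi.single 0 1 else a + Pi.single 0 1), k)
          else ((if (a 0 - (ℓ : ℤ)) % 2 = 0 then a - Pi.single 0 1 else a + Pi.single 0 1) - Pi.single k 1, k)))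
    (hcore : ∀ i, a i - b i = 0 ∨ a i - b i = -1) (hpar : (b 0 - (ℓ : ℤ)) % 2 = 0)
    (hc : ∀ k ∈ M, c k = -2 ∨ c k = 1) (hEM : E ⊆ M)
    (hΛ : ∀ w : Site 4, (∀ i, -2 ≤ w i ∧ w i ≤ 1) → ∀ k : Fin 4,
      (b k + w k < -(3 * (ℓ : ℤ) + 3) ∨ 3 * (ℓ : ℤ) + 2 < b k + w k) → (k ∈ E ∨ k = 0) ∧ k ∈ M ∧ w k = c k)
    (q : Site 4 × Fin 4) (hq : q ∈ Q) :
    (∀ i, -(3 * (ℓ : ℤ) + 3) ≤ q.1 i ∧ q.1 i ≤ 3 * ℓ + 2) ∨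
      (∀ i, -(3 * (ℓ : ℤ) + 3) ≤ (q.1 + Pi.single q.2 1 : Site 4) i ∧
        (q.1 + Pi.single q.2 1 : Site 4) i ≤ 3 * ℓ + 2) := by
  obtain ⟨w, hw, hw', hq1, hfr⟩ := collar_upper ℓ a b c M E Z Q hZ hQ hcore hpar hc hEM q hq
  by_contra h
  rw [not_or, not_forall, not_forall] at h
  obtain ⟨⟨i, hi⟩, ⟨j, hj⟩⟩ := h
  refine hfr ⟨⟨i, (hΛ w hw i ?_).2⟩, ⟨j, (hΛ _ hw' j ?_).2⟩⟩
  · rw [hq1] at hi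
    simp only [Pi.add_apply] at hi
    omega
  · rw [hq1] at hj
    simp only [Pi.add_apply] at hj ⊢
    omega

/-- **Registered helper `stub_placementCollar_aux1` of crux stmt-QuantumFields-17375** (line `pad-the-fibre`, stub
`stub_placementCollar`): the region of the collar recipe has no link inside `Ŵ` (integer chart, notation of this file) — one line (`collar_noW`). [folklore] -/
theorem stub_placementCollar_aux1 : ∀ (ℓ : ℕ) (a b c : Site 4) (M E : Finset (Fin 4)) (Z : Finset (Site 4)) (Q : Finset (Site 4 × Fin 4)) (_ : ∀ y : Site 4, y ∈ Z ↔ (∀ i, -2 ≤ y i - b i ∧ y i - b i ≤ 1) ∧ ∀ k ∈ E, y k - b k ≠ c k) (_ : ∀ q : Site 4 × Fin 4, q ∈ Q ↔ (q.1 ∈ Z ∧ q.1 + Pi.single q.2 1 ∈ Z ∧ ¬ ((∃ k ∈ M, q.1 k - b k = c k) ∧ (∃ k ∈ M, (q.1 + Pi.single q.2 1 : Site 4) k - b k = c k))) ∨ ∃ k ∈ E, q = (if c k = 1 then ((if (a 0 - (ℓ : ℤ)) % 2 = 0 then a - Pi.single 0 1 else a + Pi.single 0 1), k) else ((if (a 0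 - (ℓ : ℤ)) % 2 = 0 then a - Pi.single 0 1 else a + Pi.single 0 1) - Pi.single k 1, k))) (_ : ∀ i, a i - b i = 0 ∨ a i - b i = -1) (_ : (b 0 - (ℓ : ℤ)) % 2 = 0) (_ : ∀ k ∈ M, c k = -2 ∨ c k = 1) (_ : E ⊆ M) (_ : ∀ w : Site 4, (∀ i, -2 ≤ w i ∧ w i ≤ 1) → (∀ i, -(ℓ : ℤ) - 1 ≤ b i + w i ∧ b i + w i ≤ ℓ) → ∃ k ∈ M, w k = c k) (q : Site 4 × Fin 4) (_ : q ∈ Q), ¬ ((∀ i, -(ℓ : ℤ) - 1 ≤ q.1 i ∧ q.1 i ≤ ℓ) ∧ (∀ i, -(ℓ : ℤ) - 1 ≤ (q.1 + Pi.single q.2 1 : Site 4) i ∧ (q.1 + Pi.single q.2 1 : Site 4) i ≤ ℓ)) :=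
  collar_noW

end Summit.QuantumFields.QCD.Theorems.PadTheFibreCollar

end
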